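import Mathlib
import HarnessLib
import Summits.PneNP.PneNP.Theses.RamseyAliens
import Literature.Computability.MetaComplexity.RamseyTautologies

/-!
# Line `first-moment-wall` — skeleton for the piece `ExtremalIncompressible` (stmt-PneNP-2272)
of the split `NoExtremalPrinter ⇐ ExtremalIncompressible ∧ IncompressibleGivesTarget`
(route `RamseyAliens`, deciding crux stmt-PneNP-2270; crux-strategist BC2 redirect, 2026-08-17)

`ExtremalIncompressible` (EI) is the HARD half of the bridge split (the "Modularity" of the Wiles shape):
for every efficient universal machine `U` and every `c` there is `δ > 0` such that for infinitely many `k`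
EVERY extremal `k`-Ramsey colouring `G` of `K_{R(k)−1}` has `K_U^{m^c+c}(code ⟨m, G⟩) ≥ ⌈m^δ⌉`, `m = R(k) − 1`.

CALIBRATION (why EI must be stated at exact extremality, and what replaces it here).  Write
`m₀(k)` for the FIRST-MOMENT SCALE, the largest `m` with `2·C(m,k) < 2^{C(k,2)}` (expected number of
homogeneous `k`-sets in `G(m,1/2)` below one; Erdős 1947: `R(k) > m₀(k) ≈ (1/e√2)·k·2^{k/2}`).
(i) `C(k,2)`-wise independent edge bits (polynomials of degree `< C(k,2)` over `𝔽_{2^r}`, seed `O(k² log m) =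
O(log³ m)` bits) realise the same first moment, so for EVERY `m ≤ m₀(k)` some `k`-Ramsey graph on `m` vertices is
printable in `poly(m)` time from `O(log³ m)` advice bits: `K^{poly}(G) = O(log³ m)`.  Hence no polynomial
incompressibility statement about `k`-Ramsey graphs can hold at or below the first-moment scale — the threshold of
any true statement of EI's kind sits strictly above `m₀(k)`.  (ii) Above it, `k`-Ramsey graphs are RARE:
`Pr[G(m,1/2) is k-Ramsey] ≈ exp(−(m/m₀)^k)`; a generic sample space of `2^{m^δ}` seeds reaches density
`2^{−m^δ}`, i.e. `m ≤ 2^{δ/2}·m₀ < (4/3)·m₀` for `δ < 0.83`; crossing `(4/3)·m₀` in polynomial time with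
`m^δ` advice would be an advice-explicit Ramsey construction beating the first moment by a constant factor —
unknown for 75 years (explicit constructions reach only `m = 2^{k^{o(1)}}`: Frankl–Wilson, Barak–Rao–Shaltiel–
Wigderson, Chattopadhyay–Zuckerman, Cohen, Li), and the only known way across (alteration / Lovász Local Lemma,
Spencer 1975: `R(k) > (√2/e)·k·2^{k/2}`) needs to FIND homogeneous sets of size `≈ 2 log₂ m`, Karp's 1976 open
problem (cf. the Overlap-Gap obstructions for stable algorithms).  (iii) Exactly extremal colourings live at
`m = R(k) − 1 ≥ (1/e + o(1))·k·2^{k/2} = √2·m₀(k)` (Erdős's alteration bound), hence beyond `(4/3)·m₀(k)`.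

The line therefore factors EI into
* `stub_firstMomentWall` (E1, conjecture-grade, the load-bearing stub — `R(k)` ELIMINATED): for every `U, c`
  there is `δ > 0` such that for infinitely many `k`, every `k`-Ramsey graph on `m` vertices with
  `2^{C(k,2)} ≤ 2·C(⌊3m/4⌋, k)` (i.e. `⌊3m/4⌋ > m₀(k)`: `m` is more than a third beyond the first-moment scale)
  has `K_U^{m^c+c}(code ⟨m, G⟩) ≥ ⌈m^δ⌉`.  "Polynomial time plus `m^δ` advice cannot beat the first moment by
  the factor 4/3."  An explicit, decidable threshold replaces the inaccessible `R(k) − 1`; the statement is an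
  advice-explicit-construction lower bound with restricted-model rungs that ARE attackable now (AC⁰-succinct
  graphs — adjacency an AC⁰ function of the `2 log m` label bits — have homogeneous sets of size `2^{(log m)^{Ω(1)}}`
  by the switching lemma applied to label-respecting restrictions: the side-L analogue of `CriticalHardAC0`).
* `stub_alterationGap` (E2, KNOWN, provable now with work): eventually `2^{C(k,2)} ≤ 2·C(⌊3(R(k)−1)/4⌋, k)`,
  i.e. three quarters of the extremal size is already past the first-moment threshold — from Erdős's alteration
  bound `R(k) > n − C(n,k)·2^{1−C(k,2)}` at `n = (1/e)k2^{k/2}` (Alon–Spencer §3.1; GRS §4.2), since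
  `(3/4)·(1/e) > 1/(e√2)`; the Local Lemma (factor 2) gives more room but is not needed.
* `ExtremalIncompressible_of : E1 → E2 → ExtremalIncompressible` (PROVED here): frequent ∧ eventual is frequent,
  and at such `k` the instance `m := R(k) − 1` of E1 is literally EI's body.

`R(k)` is the tree's `Literature.Computability.MetaComplexity.diagonalRamsey k` (by `rfl` the route's inlined
`sInf {m | ∀ G : SimpleGraph (Fin m), ¬G.CliqueFree k ∨ ¬Gᶜ.CliqueFree k}`).  `sorry` appears ONLY in `stub_*`.
-/

set_option linter.dupNamespace false

namespace Summit.PneNP.PneNP.Cruxes.NoExtremalPrinter.FirstMomentWall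

open Literature.Computability.Complexity
open Literature.Computability.MetaComplexity
open Summit.PneNP.PneNP.Theses.RamseyAliens (ExtremalIncompressible NoExtremalPrinter IncompressibleGivesTarget)

noncomputable section

/-! ### The registered stubs (`sorry` lives ONLY here) -/

/-- **Stub E1 — the First-Moment Wall (conjecture-grade; load-bearing).** For every efficient universal machine `U`
and every `c` there is `δ > 0` such that for infinitely many `k`: whenever `m` is more than a third beyond the
first-moment scale of `k` (`2^{C(k,2)} ≤ 2·C(⌊3m/4⌋, k)`, i.e. the expected number of homogeneous `k`-sets of
`G(⌊3m/4⌋, 1/2)` is already `≥ 1`), EVERY `k`-Ramsey graph `G` on `Fin m` (no `k`-clique, no `k`-independent set)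
has time-bounded Kolmogorov complexity `K_U^{m^c+c}(encodingGraph.encode ⟨m, G⟩) ≥ ⌈m^δ⌉`.  Polynomial time with
`m^δ` bits of advice cannot beat the first moment by the factor `4/3`; vacuous for `m ≥ R(k)` (no such `G`).
Why it might fail: an advice-explicit construction of diagonal Ramsey graphs a constant factor beyond the
first-moment scale (none is known; Paley-type Cayley graphs do beat it for small `k`, e.g. `R(6) ≥ 102` from
`Paley(101)` against `m₀(6) = 17`, but Graham–Ringrose / Montgomery make Paley graphs lose `Ω(log log log p)`
asymptotically); or a succinct derandomisation of the alteration step in polynomial time. -/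
theorem stub_firstMomentWall :
    ∀ (U : UniversalMachine) (c : ℕ), ∃ δ : ℝ, 0 < δ ∧ ∃ᶠ k in Filter.atTop,
      ∀ m : ℕ, 2 ^ k.choose 2 ≤ 2 * (3 * m / 4).choose k →
        ∀ G : SimpleGraph (Fin m), G.CliqueFree k → Gᶜ.CliqueFree k →
          ((⌈((m : ℕ) : ℝ) ^ δ⌉₊ : ℕ) : ℕ∞) ≤ U.ktAt (m ^ c + c) (encodingGraph.encode ⟨m, G⟩) := by
  sorry

/-- **Stub E2 — the alteration gap (KNOWN; provable now, M/L).** Eventually in `k`, three quarters of the extremal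
size `R(k) − 1` is already past the first-moment threshold: `2^{C(k,2)} ≤ 2·C(⌊3(R(k)−1)/4⌋, k)`.  Erdős's
alteration (deletion) argument gives `R(k) > n − C(n,k)2^{1−C(k,2)}` for every `n`, whence
`R(k) − 1 ≥ (1/e − o(1))·k·2^{k/2}`, while `2·C(m,k) < 2^{C(k,2)}` forces `m ≤ (1/(e√2) + o(1))·k·2^{k/2}`;
as `(3/4)/e > 1/(e√2)`, `m := ⌊3(R(k)−1)/4⌋` violates the first-moment condition for large `k`
(Alon–Spencer, *The Probabilistic Method*, §3.1; Graham–Rothschild–Spencer §4.2 Thm 1–2).  In-tree inputs: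
`diagonalRamsey`, `erdos1947_ramsey_lower_holds` (the `n`-form of the first moment), `ramsey_diagonal_le_four_pow_holds`
(nonemptiness of the defining set); the alteration bound itself is to be proved (expectation over `G(n,1/2)` as a
finite average, as in `RamseyNumbers.lean`). -/
theorem stub_alterationGap :
    ∀ᶠ k in Filter.atTop, 2 ^ k.choose 2 ≤ 2 * (3 * (diagonalRamsey k - 1) / 4).choose k := by
  sorry

/-! ### Name-keyed statements of the stubs (the hypotheses of the composition) -/
namespace Registered

/-- Statement of Stub E1 (First-Moment Wall). -/
abbrev stub_firstMomentWall : Prop :=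
  ∀ (U : UniversalMachine) (c : ℕ), ∃ δ : ℝ, 0 < δ ∧ ∃ᶠ k in Filter.atTop,
    ∀ m : ℕ, 2 ^ k.choose 2 ≤ 2 * (3 * m / 4).choose k →
      ∀ G : SimpleGraph (Fin m), G.CliqueFree k → Gᶜ.CliqueFree k →
        ((⌈((m : ℕ) : ℝ) ^ δ⌉₊ : ℕ) : ℕ∞) ≤ U.ktAt (m ^ c + c) (encodingGraph.encode ⟨m, G⟩)

/-- Statement of Stub E2 (alteration gap). -/
abbrev stub_alterationGap : Prop :=
  ∀ᶠ k in Filter.atTop, 2 ^ k.choose 2 ≤ 2 * (3 * (diagonalRamsey k - 1) / 4).choose k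

end Registered

/-! ### The composition (proved, no `sorry`) -/

/-- **`ExtremalIncompressible` from the First-Moment Wall and the alteration gap.** For `U, c` take `δ` and the
frequent set of `k` from E1; its intersection with the eventual set of E2 is still frequent, and at such `k` the
extremal size `m := R(k) − 1` satisfies E1's threshold hypothesis, so E1 at `m` is literally EI's conclusion. -/
theorem ExtremalIncompressible_of
    (hW : Registered.stub_firstMomentWall) (hGap : Registered.stub_alterationGap) :
    ExtremalIncompressible := by
  intro U c
  obtain ⟨δ, hδ, hfreq⟩ := hW U c
  refine ⟨δ, hδ, ?_⟩
  refine (hfreq.and_eventually hGap).mono ?_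
  rintro k ⟨hk, hgap⟩ G hG hGc
  exact hk (diagonalRamsey k - 1) hgap G hG hGc

end

end Summit.PneNP.PneNP.Cruxes.NoExtremalPrinter.FirstMomentWall
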